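import Literature.Probability.Percolation.SharpnessQuasiTransitive
import Mathlib.Topology.Algebra.InfiniteSum.Real
import HarnessLib

/-!
# Sharpness on quasi-transitive graphs, II: finite susceptibility from `φ_p(S) < 1`
# (Duminil-Copin–Tassion 2016, CMP Thm. 1.1, item 2)

Topic `Literature/Probability/Percolation`; family `crit-perc`. Second file of the port of the
Duminil-Copin–Tassion proof of sharpness to arbitrary (quasi-transitive) locally finite graphs
(objects in `SharpnessQuasiTransitive.lean`). It formalises §1.4 of

* H. Duminil-Copin, V. Tassion, *A new proof of the sharpness of the phase transition for
  Bernoulli percolation and the Ising model*, Comm. Math. Phys. 343 (2016) 725–745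
  [DuminilCopinTassionCMP2016], Lemma 1.5 and the proof of item 2 of Thm. 1.1 ("for `β < β_c`
  the susceptibility is finite"), in the nearest-neighbour parametrisation `p = 1 - e^{-β}`,
  `J_{x,y} = 𝟙_{x ∼ y}` of §1.2 there,

for an ARBITRARY locally finite graph `G` on a countable vertex type, with the transitivity
hypothesis of the source replaced by what its proof uses: every vertex `u` carries a finite set
`S_u ∋ u` with `φ_p(u, S_u) ≤ φ₀ < 1` and `|S_u| ≤ M` (in the source, `S_u` "the image of `S` by a
fixed automorphism sending `0` to `u`"; on a quasi-transitive graph one set per orbit, see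
`SharpnessQuasiTransitiveProofs.lean`).

## Contents (namespace `Literature.Probability.Percolation.DCTQ`)

* **Lemma 1.5** (nearest-neighbour form), `real_openConnIn_le_phi_sum`: for `u ∈ S` (finite),
  `v ∉ S` and a finite `A`,
  `P_p[u ⟷ v in A] ≤ Σ_{x ∈ S} Σ_{y ∼ x, y ∉ S} p · P_p[u ⟷ x in S] · P_p[y ⟷ v in A]`.
  The source proves it with the BK inequality applied twice; here, as in the companion note
  (L'Enseignement Math. 62 (2016), §2.1) and the tree's `DCT16.exists_decomposition`, by the
  decomposition along the LAST exit of an open path from the cluster `𝒞 = {z : u ⟷ z in S}`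
  (`exists_decomposition_openConnIn`), a union bound over the values `C` of `𝒞`
  (`real_openConnIn_le_sum`), the independence of `{𝒞 = C}`, `{xy open}`, `{y ⟷ v in A ∖ C}`
  (`real_inter_three_openConnIn`) and the resummation `Σ_C P_p[𝒞 = C] = P_p[u ⟷ x in S]`.
* **Proof of item 2**, `sum_real_openConnIn_le`: with
  `χ(Λ) = max_{u ∈ Λ} Σ_{v ∈ Λ} P_p[u ⟷ v in Λ]`, Lemma 1.5 summed over `v ∈ Λ ∖ S_u` gives
  `χ(Λ) ≤ |S_u| + φ_p(u, S_u) χ(Λ) ≤ M + φ₀ χ(Λ)`, i.e. `χ(Λ) ≤ M/(1 - φ₀)`.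
* **"Taking the limit as `Λ` tends to `V`"**: `{u ⟷ v} = ⋃_n {u ⟷ v in B(u, n)}` up to the null
  set `ω ⊄ E(G)` (`openConn_subset_iUnion_openConnIn_ball`) and continuity of `P_p` from below
  give `Σ_{v ∈ F} P_p[u ⟷ v] ≤ M/(1 - φ₀)` for every finite `F` (`sum_real_openConn_le`), hence
  the summability of `v ↦ P_p[u ⟷ v]` (`summable_real_openConn`) and the bound on the
  susceptibility `Σ_v P_p[u ⟷ v] ≤ M/(1 - φ₀)` (`tsum_real_openConn_le`).

Tree anchors: `PathIn.last_exit` (`SitePaths.lean`), `DCT16.real_inter_of_determinedBy_disjoint`,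
`DCT16.determinedBy_openConnIn`, `DCT16.real_mono_of_forall_subset_edgeSet`
(`SharpnessDCTProofs.lean`), `DCTQ.determinedBy_clusterEvent`, `DCTQ.sum_real_clusterEvent`,
`DCTQ.ball` (`SharpnessQuasiTransitive.lean`). Mathlib anchors:
`MeasureTheory.tendsto_measure_iUnion_atTop`, `summable_of_sum_le`, `Real.tsum_le_of_sum_le`,
`Finset.exists_max_image`.
-/

noncomputable section

namespace Literature.Probability.Percolation.DCTQ

open _root_.MeasureTheory _root_.ProbabilityTheory LatticeModels DCT16 Finset _root_.Filter
open scoped _root_.Topology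

variable {V : Type*} {G : SimpleGraph V}

/-! ### Lemma 1.5: the decomposition along the last exit from the cluster inside `S` -/

section Decomposition

/-- `{x ⟷ y in S}` requires `y ∈ S`: for `y ∉ S` the event is empty. [folklore] -/
theorem openConnIn_eq_empty_of_notMem {S : Set V} {x y : V} (hy : y ∉ S) :
    (openConnIn S x y : Set (BondConfig V)) = ∅ :=
  Set.eq_empty_of_forall_notMem fun _ hω => hy (mem_openConnIn_iff_pathIn.1 hω).right_mem

variable [DecidableEq V] [G.LocallyFinite]

omit [DecidableEq V] in
open Classical in
/-- **The exploration step of Lemma 1.5** (Duminil-Copin–Tassion 2016, proof of Lemma 1.5, in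
the form of the companion note's §2.1). Let `u ∈ S`, `v ∉ S`, `ω ⊆ E(G)` and `u ⟷ v in A`. Then
there are `x ∈ S`, a neighbour `y ∉ S` of `x` and `C ⊆ S` containing `x` with `𝒞(ω) = C`
(`𝒞 = {z : u ⟷ z in S}`), `{x, y}` open and `y ⟷ v in A ∖ C`: follow an open path from `u` to
`v ∉ 𝒞` inside `A` up to its last visit `x` to `𝒞`.
[cite: DuminilCopinTassionCMP2016, Lemma 1.5 (proof)] -/
theorem exists_decomposition_openConnIn {S : Finset V} {u : V} (hu : u ∈ S) {A : Set V} {v : V}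
    (hv : v ∉ S) {ω : BondConfig V} (hω : ω ⊆ G.edgeSet) (h : ω ∈ openConnIn A u v) :
    ∃ x ∈ S, ∃ y ∈ G.neighborFinset x, y ∉ S ∧ ∃ C ∈ S.powerset, x ∈ C ∧
      ω ∈ clusterEvent S u C ∧ s(x, y) ∈ ω ∧ ω ∈ openConnIn (A \ ↑C) y v := by
  rw [mem_openConnIn_iff_pathIn] at h
  have hucl : u ∈ clusterSet S u ω := mem_clusterSet_iff.2 (PathIn.refl (mem_coe.2 hu))
  have hvcl : v ∉ clusterSet S u ω := fun h' => hv (mem_coe.1 (clusterSet_subset S u ω h'))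
  obtain ⟨a, b, hacl, -, hbcl, hab, hpath'⟩ := h.last_exit hucl hvcl
  have haS : a ∈ S := mem_coe.1 (clusterSet_subset S u ω hacl)
  have hbS : b ∉ S := fun hbS =>
    hbcl (mem_clusterSet_iff.2 ((mem_clusterSet_iff.1 hacl).tail hab (mem_coe.2 hbS)))
  set C : Finset V := S.filter (· ∈ clusterSet S u ω) with hCdef
  have hC : clusterSet S u ω = ↑C := (coe_filter_clusterSet S u ω).symm
  refine ⟨a, haS, b, ?_, hbS, C, ?_, ?_, hC, ((openGraph_adj ω a b).1 hab).1, ?_⟩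
  · simpa using adj_of_openGraph_adj hω hab
  · exact mem_powerset.2 (filter_subset _ _)
  · exact mem_filter.2 ⟨haS, hacl⟩
  · rw [mem_openConnIn_iff_pathIn, ← hC]
    exact hpath'

/-- **Union bound over the decomposition** (Duminil-Copin–Tassion 2016, Lemma 1.5, with the union
bound and the decomposition over the values of `𝒞` of the note's §2.1 in place of BK): for
`u ∈ S`, `v ∉ S`,
`P_p[u ⟷ v in A] ≤ Σ_{x ∈ S} Σ_{y ∼ x, y ∉ S} Σ_{x ∈ C ⊆ S} P_p[{𝒞 = C} ∩ {xy open} ∩ {y ⟷ v in A ∖ C}]`.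
[cite: DuminilCopinTassionCMP2016, Lemma 1.5] -/
theorem real_openConnIn_le_sum [Countable V] (p : unitInterval) {S : Finset V} {u : V} (hu : u ∈ S)
    (A : Set V) {v : V} (hv : v ∉ S) :
    (bondPercolation G p).real (openConnIn A u v) ≤
      ∑ x ∈ S, ∑ y ∈ G.neighborFinset x with y ∉ S, ∑ C ∈ S.powerset with x ∈ C,
        (bondPercolation G p).real
          (clusterEvent S u C ∩ {ω | s(x, y) ∈ ω} ∩ openConnIn (A \ ↑C) y v) := by
  set μ := bondPercolation G p with hμ
  calc μ.real (openConnIn A u v)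
      ≤ μ.real (⋃ x ∈ S, ⋃ y ∈ (G.neighborFinset x).filter (· ∉ S),
          ⋃ C ∈ S.powerset.filter (x ∈ ·),
            (clusterEvent S u C ∩ {ω | s(x, y) ∈ ω} ∩ openConnIn (A \ ↑C) y v)) := by
        refine real_mono_of_forall_subset_edgeSet G p fun ω hω hωA => ?_
        obtain ⟨x, hx, y, hy, hyS, C, hC, hxC, h1, h2, h3⟩ :=
          exists_decomposition_openConnIn hu hv hω hωA
        simp only [Set.mem_iUnion, mem_filter, exists_prop]
        exact ⟨x, hx, y, ⟨hy, hyS⟩, C, ⟨hC, hxC⟩, ⟨h1, h2⟩, h3⟩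
    _ ≤ ∑ x ∈ S, μ.real (⋃ y ∈ (G.neighborFinset x).filter (· ∉ S),
          ⋃ C ∈ S.powerset.filter (x ∈ ·),
            (clusterEvent S u C ∩ {ω | s(x, y) ∈ ω} ∩ openConnIn (A \ ↑C) y v)) :=
        measureReal_biUnion_finset_le _ _
    _ ≤ ∑ x ∈ S, ∑ y ∈ G.neighborFinset x with y ∉ S, μ.real
          (⋃ C ∈ S.powerset.filter (x ∈ ·),
            (clusterEvent S u C ∩ {ω | s(x, y) ∈ ω} ∩ openConnIn (A \ ↑C) y v)) :=
        sum_le_sum fun x _ => measureReal_biUnion_finset_le _ _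
    _ ≤ _ := sum_le_sum fun x _ => sum_le_sum fun y _ => measureReal_biUnion_finset_le _ _

omit [G.LocallyFinite] in
/-- **Independence of the three events** (Duminil-Copin–Tassion 2016, proof of Lemma 1.5, "the
following events occur disjointly"; here genuinely on disjoint sets of pairs, as in the note's
§2.1): for `u ∈ S`, `x ∈ C`, `y ∉ S`, `x ∼ y` and a finite `A`,
`P_p[{𝒞 = C} ∩ {xy open} ∩ {y ⟷ v in A ∖ C}] = P_p[𝒞 = C] · p · P_p[y ⟷ v in A ∖ C]` — the three
events are determined by the pairs inside `S` touching `C`, the pair `{x, y}`, and the pairs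
inside `A ∖ C`. [cite: DuminilCopinTassionCMP2016, Lemma 1.5 (proof)] -/
theorem real_inter_three_openConnIn [Countable V] (p : unitInterval) {S C : Finset V} {u : V}
    (hu : u ∈ S) {x y : V} (hxC : x ∈ C) (hyS : y ∉ S) (hxy : G.Adj x y) (A : Finset V) (v : V) :
    (bondPercolation G p).real
        (clusterEvent S u C ∩ {ω | s(x, y) ∈ ω} ∩ openConnIn (↑A \ ↑C) y v) =
      (bondPercolation G p).real (clusterEvent S u C) * p *
        (bondPercolation G p).real (openConnIn (↑A \ ↑C) y v) := by
  classical
  have hE : s(x, y) ∈ G.edgeSet := hxy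
  have hA : DeterminedBy (clusterEvent S u C) ↑(clusterPairs S C) := determinedBy_clusterEvent hu
  have hB : DeterminedBy {ω : BondConfig V | s(x, y) ∈ ω} ↑({s(x, y)} : Finset _) := by
    rw [coe_singleton]; exact determinedBy_mem _
  have hAB : DeterminedBy (clusterEvent S u C ∩ {ω | s(x, y) ∈ ω})
      ↑(clusterPairs S C ∪ {s(x, y)}) := by
    rw [coe_union]
    exact (hA.mono Set.subset_union_left).inter (hB.mono Set.subset_union_right)
  have hD : DeterminedBy (openConnIn ((↑A : Set V) \ ↑C) y v) ↑((A \ C).sym2) :=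
    determinedBy_openConnIn _ y v (by rw [coe_sym2, coe_sdiff])
  have hdisj1 : Disjoint (clusterPairs S C) {s(x, y)} := by
    rw [disjoint_singleton_right]
    intro h
    simp only [clusterPairs, Finset.mem_sdiff, Finset.mk_mem_sym2_iff] at h
    exact hyS h.1.2
  have hdisj2 : Disjoint (clusterPairs S C ∪ {s(x, y)}) ((A \ C).sym2) := by
    rw [disjoint_left]
    rintro e he he'
    rcases mem_union.1 he with he | he
    · induction e using Sym2.ind with
      | h a b =>
        obtain ⟨he1, he2⟩ := Finset.mem_sdiff.1 he
        rw [Finset.mk_mem_sym2_iff] at he1 he2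
        obtain ⟨ha', hb'⟩ := Finset.mk_mem_sym2_iff.1 he'
        rw [Finset.mem_sdiff] at ha' hb'
        exact he2 ⟨Finset.mem_sdiff.2 ⟨he1.1, ha'.2⟩, Finset.mem_sdiff.2 ⟨he1.2, hb'.2⟩⟩
    · rw [mem_singleton] at he
      subst he
      simp only [Finset.mk_mem_sym2_iff, Finset.mem_sdiff] at he'
      exact he'.1.2 hxC
  rw [real_inter_of_determinedBy_disjoint G p hAB hD hdisj2,
    real_inter_of_determinedBy_disjoint G p hA hB hdisj1, bondPercolation_cylinder G p hE]

/-- **Duminil-Copin–Tassion 2016, Lemma 1.5** (nearest-neighbour form, `p = 1 - e^{-β}`,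
`J = 𝟙_E`): for a finite `S ∋ u`, `v ∉ S` and a finite `A`,
`P_p[u ⟷ v in A] ≤ Σ_{x ∈ S} Σ_{y ∼ x, y ∉ S} p · P_p[u ⟷ x in S] · P_p[y ⟷ v in A]`.
(Printed with `S ⊆ A` and a target set `B` disjoint from `S`; the inclusion `S ⊆ A` is not used,
and `B = {v}`.) Proof: `real_openConnIn_le_sum`, `real_inter_three_openConnIn`,
`{y ⟷ v in A ∖ C} ⊆ {y ⟷ v in A}` (monotonicity in the ambient set, cf. the tree's
`openConnIn_mono` in `RSW.lean`) and `Σ_{C ∋ x} P_p[𝒞 = C] = P_p[u ⟷ x in S]`.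
[cite: DuminilCopinTassionCMP2016, Lemma 1.5] -/
theorem real_openConnIn_le_phi_sum [Countable V] (p : unitInterval) {S : Finset V} {u : V}
    (hu : u ∈ S) (A : Finset V) {v : V} (hv : v ∉ S) :
    (bondPercolation G p).real (openConnIn (↑A : Set V) u v) ≤
      ∑ x ∈ S, ∑ y ∈ G.neighborFinset x with y ∉ S,
        p * (bondPercolation G p).real (openConnIn (↑S : Set V) u x) *
          (bondPercolation G p).real (openConnIn (↑A : Set V) y v) := by
  set μ := bondPercolation G p with hμ
  refine (real_openConnIn_le_sum p hu (↑A) hv).trans ?_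
  have hterm : ∀ x ∈ S, ∀ y ∈ (G.neighborFinset x).filter (· ∉ S),
      ∀ C ∈ S.powerset.filter (x ∈ ·),
        μ.real (clusterEvent S u C ∩ {ω | s(x, y) ∈ ω} ∩ openConnIn (↑A \ ↑C) y v) ≤
          μ.real (clusterEvent S u C) * (p * μ.real (openConnIn (↑A : Set V) y v)) := by
    intro x _ y hy C hC
    rw [mem_filter, SimpleGraph.mem_neighborFinset] at hy
    rw [mem_filter] at hC
    rw [hμ, real_inter_three_openConnIn p hu hC.2 hy.2 hy.1 A v, mul_assoc]
    refine mul_le_mul_of_nonneg_left (mul_le_mul_of_nonneg_left ?_ p.2.1) measureReal_nonneg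
    exact measureReal_mono (fun ω hω => mem_openConnIn_of_pathIn
      ((pathIn_of_mem_openConnIn hω).mono Set.sdiff_subset)) (measure_ne_top _ _)
  calc ∑ x ∈ S, ∑ y ∈ G.neighborFinset x with y ∉ S, ∑ C ∈ S.powerset with x ∈ C,
        μ.real (clusterEvent S u C ∩ {ω | s(x, y) ∈ ω} ∩ openConnIn (↑A \ ↑C) y v)
      ≤ ∑ x ∈ S, ∑ y ∈ G.neighborFinset x with y ∉ S, ∑ C ∈ S.powerset with x ∈ C,
        μ.real (clusterEvent S u C) * (p * μ.real (openConnIn (↑A : Set V) y v)) :=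
        sum_le_sum fun x hx => sum_le_sum fun y hy => sum_le_sum fun C hC => hterm x hx y hy C hC
    _ = ∑ x ∈ S, ∑ y ∈ G.neighborFinset x with y ∉ S,
        μ.real (openConnIn (↑S : Set V) u x) * (p * μ.real (openConnIn (↑A : Set V) y v)) := by
        refine sum_congr rfl fun x hx => sum_congr rfl fun y _ => ?_
        rw [← sum_mul, sum_real_clusterEvent p hu hx]
    _ = _ := by
        refine sum_congr rfl fun x _ => sum_congr rfl fun y _ => ?_
        ring

end Decomposition

/-! ### Item 2: `χ(Λ) ≤ M / (1 - φ₀)` -/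

section Susceptibility

variable [DecidableEq V] [G.LocallyFinite]

/-- **Duminil-Copin–Tassion 2016, proof of item 2 of Thm. 1.1** (finite volume). Suppose every
vertex `u` carries a finite `S_u ∋ u` with `|S_u| ≤ M` and `φ_p(u, S_u) ≤ φ₀ < 1`. Then for every
finite `Λ` and `u ∈ Λ`, `Σ_{v ∈ Λ} P_p[u ⟷ v in Λ] ≤ M / (1 - φ₀)`. Printed proof: with
`χ(Λ) = max_{u ∈ Λ} Σ_{v ∈ Λ} P_p[u ⟷ v in Λ]`, attained at `w` say, Lemma 1.5 summed over
`v ∈ Λ ∖ S_w` gives `Σ_{v ∈ Λ ∖ S_w} P_p[w ⟷ v in Λ] ≤ φ_p(w, S_w) χ(Λ)`, the trivial bound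
`P ≤ 1` on `Λ ∩ S_w` gives `χ(Λ) ≤ |S_w| + φ_p(w, S_w) χ(Λ)`, whence `χ(Λ) ≤ |S|/(1 - φ_p(S))`.
[cite: DuminilCopinTassionCMP2016, Thm. 1.1(2) (proof, §1.4)] -/
theorem sum_real_openConnIn_le [Countable V] (p : unitInterval) {M : ℕ} {φ₀ : ℝ} (hφ₀ : φ₀ < 1)
    (hS : ∀ u : V, ∃ S : Finset V, u ∈ S ∧ S.card ≤ M ∧ phiAt G p u S ≤ φ₀)
    (Λ : Finset V) {u : V} (hu : u ∈ Λ) :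
    ∑ v ∈ Λ, (bondPercolation G p).real (openConnIn (↑Λ : Set V) u v) ≤ M / (1 - φ₀) := by
  set μ := bondPercolation G p with hμ
  set f : V → ℝ := fun w => ∑ v ∈ Λ, μ.real (openConnIn (↑Λ : Set V) w v) with hf
  -- `χ(Λ)` is attained at some `w ∈ Λ`
  obtain ⟨w, hw, hmax⟩ := exists_max_image Λ f ⟨u, hu⟩
  have hf0 : ∀ z, 0 ≤ f z := fun z => sum_nonneg fun _ _ => measureReal_nonneg
  suffices hkey : f w ≤ M / (1 - φ₀) from (hmax u hu).trans hkey
  obtain ⟨S, hwS, hcard, hφ⟩ := hS w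
  -- the part of the sum inside `S`: at most `|S|`
  have h1 : ∑ v ∈ Λ with v ∈ S, μ.real (openConnIn (↑Λ : Set V) w v) ≤ M := by
    calc ∑ v ∈ Λ with v ∈ S, μ.real (openConnIn (↑Λ : Set V) w v)
        ≤ ∑ _v ∈ Λ with _v ∈ S, (1 : ℝ) := sum_le_sum fun v _ => measureReal_le_one
      _ = ((Λ.filter (· ∈ S)).card : ℝ) := by rw [sum_const, nsmul_eq_mul, mul_one]
      _ ≤ (S.card : ℝ) := by
          exact_mod_cast card_le_card fun v hv => (mem_filter.1 hv).2
      _ ≤ M := by exact_mod_cast hcard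
  -- the part outside `S`: Lemma 1.5 and the maximality of `w`
  have h2 : ∑ v ∈ Λ with v ∉ S, μ.real (openConnIn (↑Λ : Set V) w v) ≤ phiAt G p w S * f w := by
    have hinner : ∀ y : V, ∑ v ∈ Λ with v ∉ S, μ.real (openConnIn (↑Λ : Set V) y v) ≤ f w := by
      intro y
      by_cases hy : y ∈ Λ
      · calc ∑ v ∈ Λ with v ∉ S, μ.real (openConnIn (↑Λ : Set V) y v)
            ≤ f y := sum_le_sum_of_subset_of_nonneg (filter_subset _ _)
                fun _ _ _ => measureReal_nonneg
          _ ≤ f w := hmax y hy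
      · have h0 : ∀ v, μ.real (openConnIn (↑Λ : Set V) y v) = 0 := by
          intro v
          have hempty : (openConnIn (↑Λ : Set V) y v : Set (BondConfig V)) = ∅ :=
            Set.eq_empty_of_forall_notMem fun _ hω =>
              hy (mem_coe.1 (mem_openConnIn_iff_pathIn.1 hω).left_mem)
          rw [hempty, measureReal_empty]
        simp only [h0, sum_const_zero]
        exact hf0 w
    calc ∑ v ∈ Λ with v ∉ S, μ.real (openConnIn (↑Λ : Set V) w v)
        ≤ ∑ v ∈ Λ with v ∉ S, ∑ x ∈ S, ∑ y ∈ G.neighborFinset x with y ∉ S,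
            p * μ.real (openConnIn (↑S : Set V) w x) * μ.real (openConnIn (↑Λ : Set V) y v) :=
          sum_le_sum fun v hv => real_openConnIn_le_phi_sum p hwS Λ (mem_filter.1 hv).2
      _ = ∑ x ∈ S, ∑ y ∈ G.neighborFinset x with y ∉ S,
            p * μ.real (openConnIn (↑S : Set V) w x) *
              ∑ v ∈ Λ with v ∉ S, μ.real (openConnIn (↑Λ : Set V) y v) := by
          rw [sum_comm]
          refine sum_congr rfl fun x _ => ?_
          rw [sum_comm]
          refine sum_congr rfl fun y _ => ?_
          rw [mul_sum]
      _ ≤ ∑ x ∈ S, ∑ y ∈ G.neighborFinset x with y ∉ S,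
            p * μ.real (openConnIn (↑S : Set V) w x) * f w :=
          sum_le_sum fun x _ => sum_le_sum fun y _ =>
            mul_le_mul_of_nonneg_left (hinner y) (mul_nonneg p.2.1 measureReal_nonneg)
      _ = phiAt G p w S * f w := by
          rw [phiAt_def, ← hμ]
          simp only [mul_sum, sum_mul]
  -- assemble: `f w ≤ M + φ₀ f w`
  have hsplit : f w = ∑ v ∈ Λ with v ∈ S, μ.real (openConnIn (↑Λ : Set V) w v) +
      ∑ v ∈ Λ with v ∉ S, μ.real (openConnIn (↑Λ : Set V) w v) :=
    (sum_filter_add_sum_filter_not Λ (· ∈ S) _).symm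
  have hle : f w ≤ M + φ₀ * f w :=
    calc f w = _ := hsplit
      _ ≤ M + phiAt G p w S * f w := add_le_add h1 h2
      _ ≤ M + φ₀ * f w := by gcongr
  have h1φ : 0 < 1 - φ₀ := by linarith
  rw [le_div_iff₀ h1φ]
  nlinarith [hle, hf0 w]

end Susceptibility

/-! ### The limit `Λ ↑ V`: summability of `v ↦ P_p[u ⟷ v]` -/

section Limit

variable [DecidableEq V] [G.LocallyFinite]

/-- **`{u ⟷ v} ⊆ ⋃_n {u ⟷ v in B(u, n)}` for `ω ⊆ E(G)`**: an open path from `u` is a walk of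
`G`, so its first `k` vertices lie in the ball `B(u, k)`. ("The result follows by taking the limit
as `Λ` tends to `V`", Duminil-Copin–Tassion 2016, §1.4.) [cite: DuminilCopinTassionCMP2016, Thm. 1.1(2) (proof, §1.4)] -/
theorem openConn_subset_iUnion_openConnIn_ball {ω : BondConfig V} (hω : ω ⊆ G.edgeSet) {u v : V}
    (h : ω ∈ (openConn u v : Set (BondConfig V))) :
    ω ∈ ⋃ n : ℕ, (openConnIn (↑(ball G u n) : Set V) u v : Set (BondConfig V)) := by
  have hpath : PathIn (openGraph ω) Set.univ u v := pathIn_univ_of_reachable h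
  have key : ∃ n : ℕ, PathIn (openGraph ω) (↑(ball G u n) : Set V) u v := by
    refine pathIn_induction (fun z => ∃ n : ℕ, PathIn (openGraph ω) (↑(ball G u n) : Set V) u z)
      hpath ⟨0, PathIn.refl (mem_coe.2 (mem_ball_self u 0))⟩ ?_
    rintro a b - - ⟨n, hn⟩ hab
    refine ⟨n + 1, (hn.mono (coe_subset.2 (subset_ball_succ u n))).tail hab ?_⟩
    exact mem_coe.2 (mem_ball_succ_of_adj (mem_coe.1 hn.right_mem) (adj_of_openGraph_adj hω hab))
  obtain ⟨n, hn⟩ := key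
  exact Set.mem_iUnion.2 ⟨n, mem_openConnIn_of_pathIn hn⟩

/-- The events `{u ⟷ v in B(u, n)}` increase with `n`. [folklore] -/
theorem monotone_openConnIn_ball (u v : V) :
    Monotone fun n : ℕ => (openConnIn (↑(ball G u n) : Set V) u v : Set (BondConfig V)) :=
  fun _ _ hmn _ hω => mem_openConnIn_of_pathIn
    ((pathIn_of_mem_openConnIn hω).mono (coe_subset.2 (ball_mono u hmn)))

/-- **Item 2 of Thm. 1.1 in infinite volume, finite partial sums**: under the hypothesis of
`sum_real_openConnIn_le`, `Σ_{v ∈ F} P_p[u ⟷ v] ≤ M/(1 - φ₀)` for every finite `F` ("taking the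
limit as `Λ` tends to `V`": `P_p[u ⟷ v in B(u, n)] ↑ P_p[u ⟷ v]` by continuity from below, and
`Σ_{v ∈ F} P_p[u ⟷ v in B(u, n)] ≤ Σ_{v ∈ B(u,n)} P_p[u ⟷ v in B(u, n)]`, the terms with
`v ∉ B(u, n)` being `0`). [cite: DuminilCopinTassionCMP2016, Thm. 1.1(2) (proof, §1.4)] -/
theorem sum_real_openConn_le [Countable V] (p : unitInterval) {M : ℕ} {φ₀ : ℝ} (hφ₀ : φ₀ < 1)
    (hS : ∀ u : V, ∃ S : Finset V, u ∈ S ∧ S.card ≤ M ∧ phiAt G p u S ≤ φ₀) (u : V)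
    (F : Finset V) :
    ∑ v ∈ F, (bondPercolation G p).real (openConn u v) ≤ M / (1 - φ₀) := by
  set μ := bondPercolation G p with hμ
  set c : ℝ := M / (1 - φ₀) with hc
  -- finite volume: the balls `B(u, n)`
  have hfin : ∀ n : ℕ, ∑ v ∈ F, μ.real (openConnIn (↑(ball G u n) : Set V) u v) ≤ c := by
    intro n
    have hzero : ∀ v ∉ ball G u n, μ.real (openConnIn (↑(ball G u n) : Set V) u v) = 0 := by
      intro v hv
      rw [openConnIn_eq_empty_of_notMem (fun h => hv (mem_coe.1 h)), measureReal_empty]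
    calc ∑ v ∈ F, μ.real (openConnIn (↑(ball G u n) : Set V) u v)
        ≤ ∑ v ∈ F ∪ ball G u n, μ.real (openConnIn (↑(ball G u n) : Set V) u v) :=
          sum_le_sum_of_subset_of_nonneg subset_union_left fun _ _ _ => measureReal_nonneg
      _ = ∑ v ∈ ball G u n, μ.real (openConnIn (↑(ball G u n) : Set V) u v) :=
          (sum_subset subset_union_right fun v _ hv => hzero v hv).symm
      _ ≤ c := sum_real_openConnIn_le p hφ₀ hS (ball G u n) (mem_ball_self u n)
  -- continuity from below
  have hlim : ∀ v, Tendsto (fun n : ℕ => μ.real (openConnIn (↑(ball G u n) : Set V) u v)) atTop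
      (𝓝 (μ.real (⋃ n : ℕ, openConnIn (↑(ball G u n) : Set V) u v))) := fun v =>
    (ENNReal.tendsto_toReal (measure_ne_top _ _)).comp
      (tendsto_measure_iUnion_atTop (monotone_openConnIn_ball u v))
  have hle : ∑ v ∈ F, μ.real (⋃ n : ℕ, openConnIn (↑(ball G u n) : Set V) u v) ≤ c :=
    le_of_tendsto' (tendsto_finsetSum F fun v _ => hlim v) hfin
  calc ∑ v ∈ F, μ.real (openConn u v)
      ≤ ∑ v ∈ F, μ.real (⋃ n : ℕ, openConnIn (↑(ball G u n) : Set V) u v) :=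
        sum_le_sum fun v _ => real_mono_of_forall_subset_edgeSet G p fun ω hω h =>
          openConn_subset_iUnion_openConnIn_ball hω h
    _ ≤ c := hle

/-- **Duminil-Copin–Tassion 2016, Thm. 1.1, item 2 (finite susceptibility), from a uniform family
of sets with `φ_p < 1`.** On a locally finite graph on countably many vertices, if every vertex `u`
carries a finite `S_u ∋ u` with `|S_u| ≤ M` and `φ_p(u, S_u) ≤ φ₀ < 1`, then `v ↦ P_p[u ⟷ v]` is
summable for every `u`, i.e. `E_p|C(u)| = Σ_v P_p[u ⟷ v] < ∞`. [cite: DuminilCopinTassionCMP2016, Thm. 1.1(2)] -/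
theorem summable_real_openConn [Countable V] (p : unitInterval) {M : ℕ} {φ₀ : ℝ} (hφ₀ : φ₀ < 1)
    (hS : ∀ u : V, ∃ S : Finset V, u ∈ S ∧ S.card ≤ M ∧ phiAt G p u S ≤ φ₀) (u : V) :
    Summable fun v => (bondPercolation G p).real (openConn u v) :=
  summable_of_sum_le (fun _ => measureReal_nonneg) (sum_real_openConn_le p hφ₀ hS u)

/-- **The susceptibility bound** `Σ_v P_p[u ⟷ v] ≤ M / (1 - φ₀)` (Duminil-Copin–Tassion 2016,
§1.4: `χ ≤ |S|/(1 - φ_β(S))`). [cite: DuminilCopinTassionCMP2016, Thm. 1.1(2) (proof, §1.4)] -/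
theorem tsum_real_openConn_le [Countable V] (p : unitInterval) {M : ℕ} {φ₀ : ℝ} (hφ₀ : φ₀ < 1)
    (hS : ∀ u : V, ∃ S : Finset V, u ∈ S ∧ S.card ≤ M ∧ phiAt G p u S ≤ φ₀) (u : V) :
    ∑' v, (bondPercolation G p).real (openConn u v) ≤ M / (1 - φ₀) :=
  Real.tsum_le_of_sum_le (fun _ => measureReal_nonneg) (sum_real_openConn_le p hφ₀ hS u)

end Limit

end Literature.Probability.Percolation.DCTQ

end
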